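import Summits.BirchSwinnertonDyer.Rank1Residual.GaloisImage.FormalGroupLocalDivisibility
import Summits.BirchSwinnertonDyer.Rank1Residual.GaloisImage.FormalGroupSharpDivisionPadic
import Mathlib.NumberTheory.Padics.HeightOneSpectrum
import HarnessLib

/-!
# The witness road's local certificate over `ℚ`: `p`-divisibility of a rational point in `E(ℚ_v)`
# from denominators / `padicValRat` (team n1011, row T-VIS3-WC FILE 2; seat p09 GEN 10)

HONEST FRAMING (cell `b2b-bsdres`, run/shared/lean/b2b/bsd-rank1-residual/, verbatim in every
file): the goal of the cell is to DELETE the COMBINATION-SHAPED residual classes of the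
Birch–Swinnerton-Dyer formula for ALL analytic-rank `≤ 1` elliptic curves over `ℚ` — "full BSD
formula for every rank `≤ 1` curve in class `C`" assembled STRICTLY from published theorems — so
that the rank-`≤ 1` remainder becomes exactly the CONSTRUCTION-SHAPED classes, which are TYPED
(missing-input `Prop`s), NOT attempted. This is not "finishing BSD". Team n1011 (N10/N11 = X4 ∧
`p = 3`, research route; ROW T-VIS3-WC = the kernel half of r1 ROUTE-1 §41.9 road F3:W).
THIS FILE IS A TOOL: theorems only (no definition, no named fact, no `sorry`); it closes nothing,
books nothing, moves no mark / label / count.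

## What and why

The first disjunct of `hdiv` in `VisibleWitness.exists_sha_ne_zero_of_congr_of_locallyDivisible`
(`∃ Q : E'(ℚ_v), p • Q = P|_{ℚ_v}`) for a rational point `P = (x, y)` of an integer model
`W = ⟨a₁, …, a₆⟩`, in the record binder shape of the cell (`hW`, `hv : primesEquiv v = ℓ`, as in
n1011-p18's `LocalThreeTorsionAdicCompletion` §3), from `decide`-able tests on `x`, `y`:

* at a place `v ∤ p` (`ℓ ≠ p`): `ℓ ∣ den x` alone (FILE 1 `exists_nsmul_eq_baseChange_of_one_lt_val`:
  the formal group is `p`-divisible away from `p`) — `exists_nsmul_eq_baseChange_of_dvd_den_of_ne`;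
* at the place of `p`, `p` ODD: `p ∣ den x` and `p² ∣ num (x / y)` (FILE 3
  `exists_nsmul_eq_of_one_lt_norm_of_norm_le`: `E⁽²⁾(ℚ_p) ⊆ p E₁(ℚ_p)`, Silverman IV.6.4(b) at the
  sharp level, transported from `ℚ_[p]` to `v.adicCompletion ℚ` along Mathlib's
  `Rat.HeightOneSpectrum.adicCompletion.padicEquiv`) — `exists_nsmul_eq_baseChange_of_padicValRat_two`;
* uniformly: **`exists_nsmul_eq_baseChange_of_dvd_den`** (`p` odd; `ℓ ∣ den x`, and
  `ℓ = p → p² ∣ num (x / y)`).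

Ingredients: §1 the norm of `ℚ_v` on rationals vs `Rat.padicValuation ℓ` (Mathlib
`valuation_equiv_padicValuation`, `FinitePlace.norm_embedding'`), `‖(x : ℚ_[p])‖` vs `padicValRat`
(Mathlib `Padic.eq_padicNorm`, `padicNorm.eq_zpow_of_nonzero`), `v_ℓ(x) < 0 ↔ ℓ ∣ den x`,
`ℓⁿ ∣ num q ⇒ n ≤ v_ℓ(q)`, `p ∈ v ↔ ℓ = p`; §2 integrality of an integer model in `ℚ_v` and `ℚ_p`;
§3 transport `E(ℚ_[p]) → E(ℚ_v)` of `n`-th roots of a rational point (`Affine.Point.map_baseChange`).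

HONEST PRICE: sufficient criteria (at `p` odd the depth `p²` is sharp inside the formal group; the
record still chooses the representative `T = m(aP₁+bP₂) - pR` of the witness class outside the
kernel — EVIDENCE: depth `≥ 2` representatives found on 475/480 witness pairs of r1's
`g29_w3_n11.tsv`, seat pilot `rep_census.py`); nothing about `θ`, ranks, `P ∉ p E(ℚ)` or any
`Visible*` file.

## References (provenance; nothing cited as a fact)

* [SilvermanAEC2009] J. H. Silverman, *The Arithmetic of Elliptic Curves*, 2nd ed.: Thm. IV.6.4,
  Prop. VII.2.2.

## Design

`noncomputable section`, `open scoped Classical NNReal`; theorems only. Axioms: `propext`,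
`Classical.choice`, `Quot.sound`.
-/

noncomputable section

open scoped Classical NNReal

namespace Summit.BirchSwinnertonDyer.Rank1Residual.GaloisImage.LocalDivisibility

open Literature.NumberTheory.EllipticCurves Literature.NumberTheory.EllipticCurves.LocalPoints
open Literature.NumberTheory.EllipticCurves.FormalGroupChart NumberField IsDedekindDomain
open Rat.HeightOneSpectrum

variable (v : HeightOneSpectrum (𝓞 ℚ))

/-! ### §1. Rational numbers in `ℚ_v` and `ℚ_p`: norms versus `padicValRat` / denominators -/

/-- **The norm of `ℚ_v` on rationals is governed by the `ℓ`-adic valuation** (`ℓ` the prime under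
`v`): `‖x‖_v ≤ ‖y‖_v ↔ v_ℓ-adic(x) ≤ v_ℓ-adic(y)` in Mathlib's `Rat.padicValuation ℓ : ℚ → ℤᵐ⁰`.
Mathlib `NumberField.FinitePlace.norm_embedding'` (`‖x‖_v = toNNReal (v.valuation ℚ x)`, strictly
monotone) and `Rat.HeightOneSpectrum.valuation_equiv_padicValuation`. [folklore] -/
theorem norm_algebraMap_le_iff {ℓ : ℕ} [Fact ℓ.Prime] (hv : (primesEquiv v : ℕ) = ℓ) (x y : ℚ) :
    ‖algebraMap ℚ (v.adicCompletion ℚ) x‖ ≤ ‖algebraMap ℚ (v.adicCompletion ℚ) y‖ ↔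
      Rat.padicValuation ℓ x ≤ Rat.padicValuation ℓ y := by
  have ex : algebraMap ℚ (v.adicCompletion ℚ) x = NumberField.FinitePlace.embedding v x := rfl
  have ey : algebraMap ℚ (v.adicCompletion ℚ) y = NumberField.FinitePlace.embedding v y := rfl
  rw [ex, ey, NumberField.FinitePlace.norm_embedding', NumberField.FinitePlace.norm_embedding',
    NNReal.coe_le_coe,
    (WithZeroMulInt.toNNReal_strictMono (NumberField.HeightOneSpectrum.one_lt_absNorm_nnreal v)).le_iff_le]
  subst hv
  exact (Rat.HeightOneSpectrum.valuation_equiv_padicValuation v) x y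

/-- The same in the currency of the norm valuation `NormedField.valuation` of `ℚ_v` (the `w` of the
tree's `FormalGroupChart`). [folklore] -/
theorem val_algebraMap_le_iff {ℓ : ℕ} [Fact ℓ.Prime] (hv : (primesEquiv v : ℕ) = ℓ) (x y : ℚ) :
    (NormedField.valuation : Valuation (v.adicCompletion ℚ) ℝ≥0) (algebraMap ℚ (v.adicCompletion ℚ) x) ≤
        (NormedField.valuation : Valuation (v.adicCompletion ℚ) ℝ≥0)
          (algebraMap ℚ (v.adicCompletion ℚ) y) ↔
      Rat.padicValuation ℓ x ≤ Rat.padicValuation ℓ y := by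
  rw [valuation_apply, valuation_apply, ← NNReal.coe_le_coe, coe_nnnorm, coe_nnnorm]
  exact norm_algebraMap_le_iff v hv x y

/-- **`1 < |x|_v ↔ ℓ ∣ den x`**: a rational lies outside the valuation ring of `ℚ_v` iff the prime
`ℓ` under `v` divides its denominator (Mathlib `Rat.padicValuation_le_one_iff`). [folklore] -/
theorem one_lt_val_algebraMap_iff_dvd_den {ℓ : ℕ} [Fact ℓ.Prime] (hv : (primesEquiv v : ℕ) = ℓ)
    (x : ℚ) :
    1 < (NormedField.valuation : Valuation (v.adicCompletion ℚ) ℝ≥0) (algebraMap ℚ (v.adicCompletion ℚ) x) ↔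
      ℓ ∣ x.den := by
  have h := val_algebraMap_le_iff v hv x 1
  simp only [map_one] at h
  rw [← not_le, h, Rat.padicValuation_le_one_iff, not_not]

/-- **`v_ℓ(x) < 0 ↔ ℓ ∣ den x`** for a rational `x` (numerator and denominator are coprime).
[folklore] -/
theorem padicValRat_lt_zero_iff_dvd_den {ℓ : ℕ} [hℓ : Fact ℓ.Prime] (x : ℚ) :
    padicValRat ℓ x < 0 ↔ ℓ ∣ x.den := by
  rw [padicValRat_def]
  constructor
  · intro h
    by_contra hnd
    rw [padicValNat.eq_zero_of_not_dvd hnd, Nat.cast_zero, sub_zero] at h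
    omega
  · intro hd
    have hnum : ¬ (ℓ : ℤ) ∣ x.num := fun hn ↦ by
      have h1 : ℓ ∣ x.num.natAbs := by simpa using Int.natAbs_dvd_natAbs.mpr hn
      exact hℓ.out.one_lt.ne' (Nat.eq_one_of_dvd_coprimes x.reduced h1 hd)
    rw [padicValInt.eq_zero_of_not_dvd hnum, Nat.cast_zero, zero_sub, neg_lt_zero]
    exact_mod_cast one_le_padicValNat_of_dvd x.den_ne_zero hd

/-- **`n ≤ v_ℓ(q)` from `ℓ ^ n ∣ num q`** (`q ≠ 0`, `n ≠ 0`: then `ℓ ∤ den q`). [folklore] -/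
theorem le_padicValRat_of_pow_dvd_num {ℓ : ℕ} [hℓ : Fact ℓ.Prime] {q : ℚ} (hq : q ≠ 0) {n : ℕ}
    (hn : n ≠ 0) (h : (ℓ : ℤ) ^ n ∣ q.num) : (n : ℤ) ≤ padicValRat ℓ q := by
  have hnum0 : q.num ≠ 0 := Rat.num_ne_zero.mpr hq
  have hnd : ¬ ℓ ∣ q.den := fun hd ↦ by
    have h1 : (ℓ : ℤ) ∣ q.num := (dvd_pow_self (ℓ : ℤ) hn).trans h
    have h2 : ℓ ∣ q.num.natAbs := by simpa using Int.natAbs_dvd_natAbs.mpr h1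
    exact hℓ.out.one_lt.ne' (Nat.eq_one_of_dvd_coprimes q.reduced h2 hd)
  rw [padicValRat_def, padicValNat.eq_zero_of_not_dvd hnd, Nat.cast_zero, sub_zero]
  rcases (padicValInt_dvd_iff n q.num).mp h with h0 | hle
  · exact absurd h0 hnum0
  · exact_mod_cast hle

/-- **`1 < ‖x‖_p` in `ℚ_p` from `v_p(x) < 0`** (Mathlib `Padic.eq_padicNorm`,
`padicNorm.eq_zpow_of_nonzero`). [folklore] -/
theorem padic_one_lt_norm_ratCast {p : ℕ} [hp : Fact p.Prime] {x : ℚ} (hx : padicValRat p x < 0) :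
    1 < ‖(x : ℚ_[p])‖ := by
  have hx0 : x ≠ 0 := by rintro rfl; simp at hx
  have hp1 : (1 : ℚ) < p := by exact_mod_cast hp.out.one_lt
  rw [Padic.eq_padicNorm, show (1 : ℝ) = ((1 : ℚ) : ℝ) by norm_num, Rat.cast_lt,
    padicNorm.eq_zpow_of_nonzero hx0, one_lt_zpow_iff_right₀ hp1, neg_pos]
  exact hx

/-- **`‖q‖_p ≤ p⁻ⁿ` in `ℚ_p` from `n ≤ v_p(q)`** (trivial for `q = 0`). [folklore] -/
theorem padic_norm_ratCast_le_inv_pow {p : ℕ} [hp : Fact p.Prime] {q : ℚ} {n : ℕ}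
    (h : q ≠ 0 → (n : ℤ) ≤ padicValRat p q) : ‖(q : ℚ_[p])‖ ≤ ((p : ℝ)⁻¹) ^ n := by
  by_cases hq : q = 0
  · rw [hq, Rat.cast_zero, norm_zero]; positivity
  have hp1 : (1 : ℚ) ≤ p := by exact_mod_cast hp.out.one_lt.le
  have e : ((p : ℝ)⁻¹) ^ n = (((p : ℚ) ^ (-(n : ℤ)) : ℚ) : ℝ) := by
    push_cast
    rw [inv_pow, ← zpow_natCast, ← zpow_neg]
  rw [Padic.eq_padicNorm, padicNorm.eq_zpow_of_nonzero hq, e, Rat.cast_le]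
  exact zpow_le_zpow_right₀ hp1 (neg_le_neg (h hq))

/-- **`p ∈ v ↔ ℓ = p`** for primes `p`, `ℓ` with `primesEquiv v = ℓ` (Mathlib
`Rat.HeightOneSpectrum.natGenerator_dvd_iff`). [folklore] -/
theorem natCast_mem_asIdeal_iff_eq {ℓ : ℕ} [hℓ : Fact ℓ.Prime] (hv : (primesEquiv v : ℕ) = ℓ)
    {p : ℕ} (hp : p.Prime) : ((p : ℕ) : 𝓞 ℚ) ∈ v.asIdeal ↔ ℓ = p := by
  have key : ((p : ℕ) : 𝓞 ℚ) ∈ v.asIdeal ↔ natGenerator v ∣ p := by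
    rw [natGenerator_dvd_iff, Ideal.mem_map_of_equiv]
    constructor
    · intro h
      exact ⟨p, h, map_natCast _ p⟩
    · rintro ⟨x, hx, hxn⟩
      have : x = p := (Rat.IsIntegralClosure.intEquiv (𝓞 ℚ)).injective (by rw [hxn, map_natCast])
      rwa [this] at hx
  have hgen : natGenerator v = ℓ := hv
  rw [key, hgen, Nat.prime_dvd_prime_iff_eq hℓ.out hp]

/-! ### §2. Integrality of an integer model, in `ℚ_v` and in `ℚ_p` -/

/-- **An integer Weierstrass model over `ℚ` is `v`-integral in `ℚ_v`** for every finite place `v`: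
the `IsIntegral` instance (Mathlib, valuation ring of the norm valuation) of `W ⊗ ℚ_v` for
`W = ⟨a₁, …, a₆⟩` with `aᵢ ∈ ℤ` — the record binder shape `hW`. [folklore] -/
theorem isIntegral_baseChange_adicCompletion_of_eq_mk (a₁ a₂ a₃ a₄ a₆ : ℤ) (W : WeierstrassCurve ℚ)
    (hW : W = ⟨a₁, a₂, a₃, a₄, a₆⟩) :
    (W.baseChange (v.adicCompletion ℚ)).IsIntegral
      ((NormedField.valuation : Valuation (v.adicCompletion ℚ) ℝ≥0)).integer := by
  have hle : ∀ a : ℤ, algebraMap ℚ (v.adicCompletion ℚ) (a : ℚ) ∈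
      ((NormedField.valuation : Valuation (v.adicCompletion ℚ) ℝ≥0)).integer := fun a ↦ by
    rw [Valuation.mem_integer_iff, valuation_apply, ← NNReal.coe_le_coe, coe_nnnorm, NNReal.coe_one]
    have h := NumberField.FinitePlace.norm_le_one ℚ v (a : 𝓞 ℚ)
    rw [NumberField.FinitePlace.embedding_apply, map_intCast] at h
    exact h
  subst hW
  exact WeierstrassCurve.isIntegral_of_exists_lift _ ⟨⟨_, hle a₁⟩, rfl⟩ ⟨⟨_, hle a₂⟩, rfl⟩
    ⟨⟨_, hle a₃⟩, rfl⟩ ⟨⟨_, hle a₄⟩, rfl⟩ ⟨⟨_, hle a₆⟩, rfl⟩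

/-- **An integer Weierstrass model over `ℚ` is `p`-integral in `ℚ_p`** (`W ⊗ ℚ_p` has the cast
integer coefficients). [folklore] -/
theorem isIntegral_baseChange_padic_of_eq_mk (a₁ a₂ a₃ a₄ a₆ : ℤ) (W : WeierstrassCurve ℚ)
    (hW : W = ⟨a₁, a₂, a₃, a₄, a₆⟩) (p : ℕ) [Fact p.Prime] :
    (W.baseChange ℚ_[p]).IsIntegral ℤ_[p] := by
  subst hW
  refine WeierstrassCurve.isIntegral_of_exists_lift _ ⟨(a₁ : ℤ_[p]), ?_⟩ ⟨(a₂ : ℤ_[p]), ?_⟩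
    ⟨(a₃ : ℤ_[p]), ?_⟩ ⟨(a₄ : ℤ_[p]), ?_⟩ ⟨(a₆ : ℤ_[p]), ?_⟩ <;>
    simp [WeierstrassCurve.baseChange, WeierstrassCurve.map]

/-! ### §3. Transport of `n`-th roots of a rational point from `E(ℚ_p)` to `E(ℚ_v)` -/

/-- **An `n`-th root of `P|_{ℚ_p}` in `E(ℚ_[p])` gives an `n`-th root of `P|_{ℚ_v}` in `E(ℚ_v)`** for
the place `v` of `ℚ` over `p`: transport along Mathlib's continuous `ℚ`-algebra isomorphism
`adicCompletion.padicEquiv v : v.adicCompletion ℚ ≃A[ℚ] ℚ_[primesEquiv v]` (`Affine.Point.map` of its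
inverse is additive and fixes rational points, `Affine.Point.map_baseChange`). [folklore] -/
theorem exists_nsmul_eq_baseChange_adicCompletion_of_padic (W : WeierstrassCurve ℚ)
    {v : HeightOneSpectrum (𝓞 ℚ)} {p : ℕ} [Fact p.Prime] (hv : (primesEquiv v : ℕ) = p)
    (P : (W.baseChange ℚ).toAffine.Point) (n : ℕ)
    (h : ∃ Q' : (W.baseChange ℚ_[p]).toAffine.Point,
      n • Q' = WeierstrassCurve.Affine.Point.baseChange (W' := W) ℚ ℚ_[p] P) :
    ∃ Q : (W.baseChange (v.adicCompletion ℚ)).toAffine.Point,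
      n • Q = WeierstrassCurve.Affine.Point.baseChange (W' := W) ℚ (v.adicCompletion ℚ) P := by
  subst hv
  obtain ⟨Q', hQ'⟩ := h
  let ψ : ℚ_[(primesEquiv v : ℕ)] →ₐ[ℚ] v.adicCompletion ℚ :=
    ((adicCompletion.padicEquiv v).symm : ℚ_[(primesEquiv v : ℕ)] ≃A[ℚ] v.adicCompletion ℚ)
  refine ⟨WeierstrassCurve.Affine.Point.map (W' := W) ψ Q', ?_⟩
  rw [← map_nsmul, hQ', WeierstrassCurve.Affine.Point.map_baseChange]

/-! ### §4. ENDs over `ℚ`: the first disjunct of `hdiv` from denominators / `padicValRat` -/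

/-- **END at a place `v ∤ p`** (`ℓ ≠ p`): for `W = ⟨a₁, …, a₆⟩` (`aᵢ ∈ ℤ`) elliptic, primes `p`, `ℓ`,
`v` the place over `ℓ`, and `P = (x, y) ∈ E(ℚ)` with `ℓ ∣ den x` (i.e. `P|_{ℚ_v}` in the kernel of
reduction), `P|_{ℚ_v} = p • Q` for some `Q ∈ E(ℚ_v)` — FILE 1's `exists_nsmul_eq_baseChange_of_one_lt_val`
(the formal group is `p`-divisible away from `p`). [cite: SilvermanAEC2009, Thm. IV.6.4]
[cite: SilvermanAEC2009, Prop. VII.2.2] -/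
theorem exists_nsmul_eq_baseChange_of_dvd_den_of_ne (a₁ a₂ a₃ a₄ a₆ : ℤ) (W : WeierstrassCurve ℚ)
    [W.IsElliptic] (hW : W = ⟨a₁, a₂, a₃, a₄, a₆⟩) {p ℓ : ℕ} [hp : Fact p.Prime] [Fact ℓ.Prime]
    (hℓp : ℓ ≠ p) {v : HeightOneSpectrum (𝓞 ℚ)} (hv : (primesEquiv v : ℕ) = ℓ) {x y : ℚ}
    (h : W.toAffine.Nonsingular x y) (hx : ℓ ∣ x.den) :
    ∃ Q : (W.baseChange (v.adicCompletion ℚ)).toAffine.Point,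
      p • Q = WeierstrassCurve.Affine.Point.baseChange (W' := W) ℚ (v.adicCompletion ℚ)
        (.some x y h) := by
  haveI := isIntegral_baseChange_adicCompletion_of_eq_mk v a₁ a₂ a₃ a₄ a₆ W hW
  have hpv : ((p : ℕ) : 𝓞 ℚ) ∉ v.asIdeal := fun hmem ↦
    hℓp ((natCast_mem_asIdeal_iff_eq v hv hp.out).mp hmem)
  exact exists_nsmul_eq_baseChange_of_one_lt_val v W hpv h
    ((one_lt_val_algebraMap_iff_dvd_den v hv x).mpr hx)

/-- **END at the place of an ODD `p`, sharp depth** (`E⁽²⁾(ℚ_p) ⊆ p E₁(ℚ_p)`, FILE 3): for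
`W = ⟨a₁, …, a₆⟩` elliptic, `p ≠ 2`, `v` the place over `p`, and `P = (x, y) ∈ E(ℚ)` with
`v_p(x) < 0` and `v_p(x / y) ≥ 2` (when `x / y ≠ 0`), `P|_{ℚ_v} = p • Q` for some `Q ∈ E(ℚ_v)`
(proved in `E(ℚ_[p])` by `exists_nsmul_eq_of_one_lt_norm_of_norm_le`, transported by §3).
[cite: SilvermanAEC2009, Thm. IV.6.4] [cite: SilvermanAEC2009, Prop. VII.2.2] -/
theorem exists_nsmul_eq_baseChange_of_padicValRat_two (a₁ a₂ a₃ a₄ a₆ : ℤ) (W : WeierstrassCurve ℚ)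
    [W.IsElliptic] (hW : W = ⟨a₁, a₂, a₃, a₄, a₆⟩) {p : ℕ} [hp : Fact p.Prime] (hp2 : p ≠ 2)
    {v : HeightOneSpectrum (𝓞 ℚ)} (hv : (primesEquiv v : ℕ) = p) {x y : ℚ}
    (h : W.toAffine.Nonsingular x y) (hx : padicValRat p x < 0)
    (hz : x / y ≠ 0 → (2 : ℤ) ≤ padicValRat p (x / y)) :
    ∃ Q : (W.baseChange (v.adicCompletion ℚ)).toAffine.Point,
      p • Q = WeierstrassCurve.Affine.Point.baseChange (W' := W) ℚ (v.adicCompletion ℚ)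
        (.some x y h) := by
  refine exists_nsmul_eq_baseChange_adicCompletion_of_padic W hv _ p ?_
  haveI := isIntegral_baseChange_padic_of_eq_mk a₁ a₂ a₃ a₄ a₆ W hW p
  rw [show WeierstrassCurve.Affine.Point.baseChange (W' := W) ℚ ℚ_[p] (.some x y h) =
      WeierstrassCurve.Affine.Point.map (W' := W) (Algebra.ofId ℚ ℚ_[p]) (.some x y h) from rfl,
    WeierstrassCurve.Affine.Point.map_some]
  refine exists_nsmul_eq_of_one_lt_norm_of_norm_le (W.baseChange ℚ_[p]) hp2 _ ?_ ?_
  · rw [show (Algebra.ofId ℚ ℚ_[p]) x = (x : ℚ_[p]) from eq_ratCast _ x]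
    exact padic_one_lt_norm_ratCast hx
  · rw [show (Algebra.ofId ℚ ℚ_[p]) x = (x : ℚ_[p]) from eq_ratCast _ x,
      show (Algebra.ofId ℚ ℚ_[p]) y = (y : ℚ_[p]) from eq_ratCast _ y, ← Rat.cast_div]
    exact padic_norm_ratCast_le_inv_pow (n := 2) fun hq ↦ hz hq

/-- **END over `ℚ`, denominator / numerator currency, `p` odd** (`decide`-able on literals): for
`W = ⟨a₁, …, a₆⟩` elliptic, primes `p ≠ 2` and `ℓ`, `v` the place over `ℓ`, and `P = (x, y) ∈ E(ℚ)`
with `ℓ ∣ den x` and, if `ℓ = p`, `p² ∣ num (x / y)`: `P|_{ℚ_v} = p • Q` for some `Q ∈ E(ℚ_v)` —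
literally the first disjunct of `hdiv` at `v` in
`VisibleWitness.exists_sha_ne_zero_of_congr_of_locallyDivisible` (`K = ℚ`). (For a reduced fraction
`q ≠ 0` with `p ∣ num q`, `v_p(q) = v_p(num q)`; `q = 0` passes trivially.)
[cite: SilvermanAEC2009, Thm. IV.6.4] [cite: SilvermanAEC2009, Prop. VII.2.2] -/
theorem exists_nsmul_eq_baseChange_of_dvd_den (a₁ a₂ a₃ a₄ a₆ : ℤ) (W : WeierstrassCurve ℚ)
    [W.IsElliptic] (hW : W = ⟨a₁, a₂, a₃, a₄, a₆⟩) {p ℓ : ℕ} [hp : Fact p.Prime] [Fact ℓ.Prime]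
    (hp2 : p ≠ 2) {v : HeightOneSpectrum (𝓞 ℚ)} (hv : (primesEquiv v : ℕ) = ℓ) {x y : ℚ}
    (h : W.toAffine.Nonsingular x y) (hx : ℓ ∣ x.den) (hz : ℓ = p → (p : ℤ) ^ 2 ∣ (x / y).num) :
    ∃ Q : (W.baseChange (v.adicCompletion ℚ)).toAffine.Point,
      p • Q = WeierstrassCurve.Affine.Point.baseChange (W' := W) ℚ (v.adicCompletion ℚ)
        (.some x y h) := by
  by_cases hℓp : ℓ = p
  · subst hℓp
    exact exists_nsmul_eq_baseChange_of_padicValRat_two a₁ a₂ a₃ a₄ a₆ W hW hp2 hv h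
      ((padicValRat_lt_zero_iff_dvd_den x).mpr hx)
      fun hq0 ↦ le_padicValRat_of_pow_dvd_num hq0 two_ne_zero (hz rfl)
  · exact exists_nsmul_eq_baseChange_of_dvd_den_of_ne a₁ a₂ a₃ a₄ a₆ W hW hℓp hv h hx


/-! ### §5. One instance (self-test of the numeral road; EVIDENCE-grade inputs displayed as binders) -/

/-- **Instance `18774l1`** (`[1, -1, 0, 12690, 862164]`, rank 2; the partner of the N11 row `18774o1`
in r1's T-VIS3 census, ROUTE-1 §41.7: the line `⟨P₁⟩` of `E'(ℚ)/3`, `P₁ = (117, 1926)`,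
`P₂ = (12, 1002)`, is 3-divisible in `E'(ℚ₃)`): the representative `T = -2P₁ + 3P₂ =
(-3956/81, -239014/729)` of the class of `P₁` modulo `3E'(ℚ)` lies in `E'₁(ℚ₃)` at depth `2`
(`81 = 3⁴ ∣ den x`, `9 ∣ num (x/y)`), so `T|_{ℚ_v} ∈ 3·E'(ℚ_v)` at the place `v` of `3` — the first
disjunct of `hdiv` at `v = 3` for this witness, both tests by `decide +kernel`. Ellipticity and the
point's nonsingularity are displayed as binders (the records seat discharges them); `T ∉ 3E'(ℚ)`,
`θ`, ranks are NOT claimed here. [cite: SilvermanAEC2009, Thm. IV.6.4]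
[cite: SilvermanAEC2009, Prop. VII.2.2] -/
theorem exists_nsmul_eq_baseChange_18774l1_three (W' : WeierstrassCurve ℚ) [W'.IsElliptic]
    (hW' : W' = ⟨1, -1, 0, 12690, 862164⟩) {v : HeightOneSpectrum (𝓞 ℚ)}
    (hv : (primesEquiv v : ℕ) = 3) (h : W'.toAffine.Nonsingular (-3956 / 81) (-239014 / 729)) :
    ∃ Q : (W'.baseChange (v.adicCompletion ℚ)).toAffine.Point,
      3 • Q = WeierstrassCurve.Affine.Point.baseChange (W' := W') ℚ (v.adicCompletion ℚ)
        (.some (-3956 / 81) (-239014 / 729) h) :=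
  exists_nsmul_eq_baseChange_of_dvd_den 1 (-1) 0 12690 862164 W' hW' (p := 3) (by norm_num) hv h
    (by decide +kernel) (fun _ ↦ by decide +kernel)

end Summit.BirchSwinnertonDyer.Rank1Residual.GaloisImage.LocalDivisibility

end
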